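import Summits.CriticalPhenomena.CardyFormulaZ2.Theorems.CardyComplexConeEdgePrecompactVertexRelationChainWinding
import Literature.Probability.LatticeModels.InterfaceRearrangement

/-!
# The loop spliced into the exploration path at an interior edge turns with the sign of the turn
(line `qkz-strip-boundary-arm` of crux `CardyComplexCone.EdgePrecompact`, stmt-CriticalPhenomena-11387;
second file of the stub `stub_vertexRelation`, the `q = 1` half-Cauchy–Riemann vertex relation)

The per-pair identity behind the vertex relation (edge-flip involution `ω ↦ ω △ {e}` at an interior
medial vertex `e = cTgt p`; cases 1/2 of `InterfaceRearrangement.lean`) holds if and only if the loop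
`L` of the loop representation through the partner corner `p₂` of the dart `p` of the path — the loop
spliced into the path when `e` is toggled — has turning number `4 · turnSign p`: counterclockwise when
the path crosses `e`, clockwise when it follows `e`; equivalently, the path lies OUTSIDE `L`. This
fails for admissible data on multiply connected discrete domains (marked points on a hole: `L` may
encircle the whole interface; exact enumeration, evidence `vertexRelation_hole_cex.md` of the item) and
holds for the discretisation of a Jordan domain, which is what this file proves
(`spliceLoop_turning_eq`, registered sub-goal):

1. `L` consists of inner corners and misses the whole (periodic) interface orbit: its inner corners
   would be darts of the path (`isInnerFace_cornerOrbit_iff`), and a step of `L` out of the inner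
   faces would cross a face-boundary edge at an `A`-vertex — the unique exit corner, which is a dart
   of the path — or at a `B`-vertex, around which the loop would pivot for ever.
2. The outer face at `e_a` is joined through side-adjacent non-inner faces to faces above all inner
   faces (`holeFree_innerFaces`: the inner faces of the discretisation of a Jordan domain are
   hole-free, from the Jordan curve theorem), then westwards as far as needed; lifting this face path
   (`exists_chain_of_reach`) gives a corner chain from far in the north-west into the start corner,
   continued along the path up to the dart after `p`; it avoids `L` by 1.
3. `chainWinding_eq_zero` (previous file; tube lemma): the winding number of the closed trail of `L`
   vanishes on the medial faces of the dart after `p` — the right face of the dart of `p₂` if `e` is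
   closed, its left face if `e` is open — and the signed combinatorial Umlaufsatz
   (`MedialTrail.inv_of_isTrail`, `INV.rf_cases`, `cturn_cornerOrbit`) converts this into the turning
   number `+4`, resp. `−4`.

References: S. Smirnov, Ann. of Math. 172 (2010), proof of Lemma 4.5 and Fig. 5; H. Duminil-Copin,
S. Smirnov, *Conformal invariance of lattice models*, arXiv:1109.1549, §8 (Prop. 8.6, the `q = 1`
vertex relation); G. Grimmett, *The Random-Cluster Model* (2006), §6.1 (loops separate clusters from
dual clusters).
-/

namespace Summit.CriticalPhenomena.CardyFormulaZ2.Cruxes.EdgePrecompact.QkzStripBoundaryArm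

open MeasureTheory Filter Set Metric
open scoped Topology BigOperators Pointwise
open Literature.Probability.LatticeModels Literature.Probability.Percolation
open Literature.Probability.RandomPlanarGeometry (DobrushinDomain)
open Summit.CriticalPhenomena.CardyFormulaZ2.Theses.CardyComplexCone

/-! ## Interior vertices; the loop through the partner -/

/-- A vertex all four of whose faces are inner is not a boundary site (neither a `meshBoundary` site
nor an endpoint of a face-boundary edge). -/
theorem not_mem_zdBoundary_of_forall_isInnerFace {E : DiscreteDobrushin} {v : Site 2}
    (hall : ∀ j, E.IsInnerFace (faceAt v j)) : v ∉ E.zdBoundary := by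
  rintro (⟨-, w, hvw, hnot⟩ | ⟨w, -, -, g, hg, hvg, -⟩)
  · obtain ⟨k, rfl⟩ := exists_eq_add_cornerUnit hvw
    exact hnot (DiscreteDobrushin.adj_of_isInnerFace_faceAt (hall k) (Or.inl rfl))
  · obtain ⟨k, rfl⟩ := exists_faceAt_of_isCorner hvg
    exact hg (hall k)

/-- **The spliced loop turns with the sign of the turn at the toggled edge** (registered sub-goal
`spliceLoop_turning_eq` of stmt-CriticalPhenomena-11387; the planar input of the per-pair identity of
the vertex relation). For the discretisation `E` of a JORDAN Dobrushin domain (`E.Ω = D.carrier`),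
admissible, let `p = orb i₁` be a dart of the exploration path (cut orbit of the start corner `c₀`,
exit time `N`) whose partner `p₂` (the other corner arriving at `e = cTgt p`) is not a dart of the
path, all four faces at the far endpoint of `e` being inner, and let `Q` be the minimal period of the
cycle `L` of `p₂` under the turning rule. Then `∑_{m<Q} turnSign (orb_L m) = 4 · turnSign p`: the loop
`L` is counterclockwise if the path crosses `e` (closed) and clockwise if it follows `e` (open) —
i.e. the path lies outside `L`. Proof: `L` consists of inner corners and misses the whole interface
orbit; the outer face at `e_a` is joined through non-inner faces to faces arbitrarily high
(`holeFree_innerFaces`, Jordan curve theorem), whence a corner chain from far away into `c₀` and along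
the path up to the dart after `p`, avoiding `L`; by `chainWinding_eq_zero` the winding number of `L`
vanishes on the medial faces of that dart, which are the right face (closed `e`) or the left face
(open `e`) of the dart of `p₂`; the combinatorial Umlaufsatz with signs (`MedialTrail.inv_of_isTrail`,
`INV.rf_cases`) then gives the turning number `+4`, resp. `−4`. -/
theorem spliceLoop_turning_eq : ∀ (D : DobrushinDomain) (E : DiscreteDobrushin), E.Ω = D.carrier → E.IsZdAdmissible → ∀ (ω : BondConfig (Site 2)) (c₀ p : Site 2 × Fin 4) (N i₁ Q : ℕ), E.IsStartCorner c₀ → ¬ E.IsInnerFace (cFace (cornerOrbit (E.bcBondConfig ω) c₀ N)) → (∀ k < N, E.IsInnerFace (cFace (cornerOrbit (E.bcBondConfig ω) c₀ k))) → cornerOrbit (E.bcBondConfig ω) c₀ i₁ = p → i₁ < N → (∀ i < N, cornerOrbit (E.bcBondConfig ω) c₀ i ≠ cornerPartner p) → (∀ j, E.IsInnerFace (faceAt (p.1 + cornerUnit (p.2 + 1)) j)) → 0 < Q → cornerOrbit (E.bcBondConfig ω) (cornerPartner p) Q = cornerPartner p → (∀ s, 0 < s → s < Q → cornerOrbit (E.bcBondConfig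 ω) (cornerPartner p) s ≠ cornerPartner p) → ∑ m ∈ Finset.range Q, turnSign (E.bcBondConfig ω) (cornerOrbit (E.bcBondConfig ω) (cornerPartner p) m) = 4 * turnSign (E.bcBondConfig ω) p := by
  intro D E hΩ hE ω c₀ p N i₁ Q hc₀ hN hlt hi₁ hi₁N h₂ hy hQ0 hQ hQmin
  classical
  have hstep : ∀ (c : Site 2 × Fin 4) (i : ℕ), cornerOrbit (E.bcBondConfig ω) c (i + 1) =
      nextCorner (E.bcBondConfig ω) (cornerOrbit (E.bcBondConfig ω) c i) := fun c i => rfl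
  -- the partner, its vertex `y`, its (inner) face
  have hp₂in : E.IsInnerFace (cFace (cornerPartner p)) := hy _
  have hyBd : (cornerPartner p).1 ∉ E.zdBoundary := not_mem_zdBoundary_of_forall_isInnerFace hy
  have hyB : (cornerPartner p).1 ∉ E.zdArcB := fun h => hyBd (E.zdArcB_subset_zdBoundary h)
  -- `p` is not the last dart
  have hi₁1 : i₁ + 1 < N := by
    by_contra hcon
    have hN1 : N = i₁ + 1 := by omega
    subst hN1
    obtain ⟨-, -, hB, -⟩ := cornerOrbit_exit hE hc₀ (n := i₁) (hlt i₁ hi₁N) hN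
    rw [hi₁] at hB
    exact hyB hB
  -- the interface orbit is periodic; the loop through the partner misses it entirely
  have hc₀mesh : c₀.1 ∈ meshDomain E.Ω E.δ := fst_mem_meshDomain_of_isInnerFace (q := c₀) hc₀.isOutEdge.1
  have hexP : ∃ P, 0 < P ∧ cornerOrbit (E.bcBondConfig ω) c₀ P = c₀ := exists_cornerOrbit_period hE hc₀mesh
  have hP₀0 : 0 < Nat.find hexP := (Nat.find_spec hexP).1
  have hP₀ : cornerOrbit (E.bcBondConfig ω) c₀ (Nat.find hexP) = c₀ := (Nat.find_spec hexP).2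
  have hP₀min : ∀ s, 0 < s → s < Nat.find hexP → cornerOrbit (E.bcBondConfig ω) c₀ s ≠ c₀ :=
    fun s hs hsP h => Nat.find_min hexP hsP ⟨hs, h⟩
  have hdisj : ∀ m s, cornerOrbit (E.bcBondConfig ω) (cornerPartner p) m ≠ cornerOrbit (E.bcBondConfig ω) c₀ s := by
    intro m s h
    obtain ⟨s', hs'⟩ := exists_eq_cornerOrbit_of_iterate hP₀0 hP₀ m h
    have hin : E.IsInnerFace (cFace (cornerOrbit (E.bcBondConfig ω) c₀ s')) := hs' ▸ hp₂in
    rw [isInnerFace_cornerOrbit_iff hE hc₀ hN hlt hP₀0 hP₀ hP₀min] at hin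
    exact h₂ _ hin (by rw [cornerOrbit_mod_period hP₀]; exact hs'.symm)
  -- the loop consists of inner corners
  have hLin : ∀ m, E.IsInnerFace (cFace (cornerOrbit (E.bcBondConfig ω) (cornerPartner p) m)) := by
    intro m
    induction m with
    | zero => exact hp₂in
    | succ m ih =>
      by_contra hout
      set q := cornerOrbit (E.bcBondConfig ω) (cornerPartner p) m with hq
      have hclosed : cTgt q ∉ E.bcBondConfig ω := fun h =>
        hout (by rw [hstep, cFace_nextCorner_of_mem h]; exact ih)
      have hIn : E.IsInEdge q.1 (q.2 + 1) := by
        refine ⟨by rw [fin4_add_one_add_three]; exact ih, ?_⟩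
        rwa [hstep, cFace_nextCorner_of_not_mem hclosed] at hout
      obtain ⟨h1, h2⟩ := hE.arcs_cover_faceBoundary hIn.isFaceBoundaryEdge
      rcases h1 with hA | hB
      · -- `q` would be the exit corner, which lies on the interface orbit
        have hB' : q.1 + cornerUnit (q.2 + 1) ∈ E.zdArcB := by
          rcases h2 with h2 | h2
          · refine absurd (DiscreteDobrushin.mem_bcBondConfig_of_arcA hIn.isFaceBoundaryEdge.1 ?_) hclosed
            intro x hx
            rcases Sym2.mem_iff.1 hx with rfl | rfl
            · exact hA
            · exact h2
          · exact h2
        have hexit : E.IsExitCorner q := ⟨hA, hB', hIn⟩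
        obtain ⟨N₁, rfl⟩ : ∃ N₁, N = N₁ + 1 := ⟨N - 1, by omega⟩
        have hexitN := isExitCorner_cornerOrbit hE hc₀ (hlt N₁ (Nat.lt_succ_self _)) hN
        exact hdisj m N₁ (hexit.eq hE hexitN)
      · -- all target edges at a `B`-vertex are closed: the loop pivots around `q.1` for ever
        have hv : ∀ t, (cornerOrbit (E.bcBondConfig ω) q t).1 = q.1 := by
          intro t
          induction t with
          | zero => rfl
          | succ t iht =>
            rw [hstep, nextCorner_of_not_mem]
            · exact iht
            · exact DiscreteDobrushin.not_mem_bcBondConfig_of_mem_zdArcB hE (Sym2.mem_mk_left _ _) (iht.symm ▸ hB)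
        have hper : cornerOrbit (E.bcBondConfig ω) (cornerPartner p) (0 + (m + 1) * Q) = cornerPartner p :=
          cornerOrbit_add_mul_period hQ 0 (m + 1)
        have hsplit : cornerOrbit (E.bcBondConfig ω) (cornerPartner p) (0 + (m + 1) * Q) =
            cornerOrbit (E.bcBondConfig ω) q ((m + 1) * Q - m) := by
          rw [hq, cornerOrbit_eq_iterate, cornerOrbit_eq_iterate, cornerOrbit_eq_iterate,
            ← Function.iterate_add_apply]
          congr 1
          have : m ≤ (m + 1) * Q := by nlinarith
          omega
        apply hyB
        rw [← hper, hsplit, hv]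
        exact hB
  -- bounds: the loop's vertices lie in the finite discrete domain; inner faces are bounded above
  have hΩb : Bornology.IsBounded E.Ω := by rw [hΩ]; exact D.isBounded
  have hfinD := meshDomain_finite hΩb hE.delta_pos
  obtain ⟨B, hB⟩ := (hfinD.image fun w : Site 2 => w 1 - w 0).bddAbove
  have hBm : ∀ m, (cornerOrbit (E.bcBondConfig ω) (cornerPartner p) m).1 1 -
      (cornerOrbit (E.bcBondConfig ω) (cornerPartner p) m).1 0 ≤ B :=
    fun m => hB ⟨_, fst_mem_meshDomain_of_isInnerFace (hLin m), rfl⟩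
  have hfinF : {f : Site 2 | E.IsInnerFace f}.Finite := finite_hasAllSides hΩb hE.delta_pos
  obtain ⟨Y, hY⟩ := (hfinF.image fun f : Site 2 => f 1).bddAbove
  have hY' : ∀ f, E.IsInnerFace f → f 1 ≤ Y := fun f hf => hY ⟨f, hf, rfl⟩
  -- the outer face at `e_a` escapes to the north (hole-freeness, Jordan curve theorem), then west
  have hg₀ : ¬ E.IsInnerFace (faceAt c₀.1 (c₀.2 + 3)) := hc₀.isOutEdge.2
  obtain ⟨g', hg'Y, hreach⟩ := holeFree_innerFaces D.toJordanDomain hΩ hE.delta_pos _ hg₀ (Y + 1)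
  set n : ℕ := (B + 2 - (g' 1 - g' 0)).toNat with hn
  have hreach' : Relation.ReflTransGen (FaceStep {f | E.IsInnerFace f}) (faceAt c₀.1 (c₀.2 + 3))
      (g' + n • cornerUnit 2) := by
    refine reflTransGen_faceStep_nsmul hg₀ hreach 2 (fun n' hin => ?_) n
    have := hY' _ hin
    simp [cornerUnit] at this
    omega
  have hgfar : B + 2 ≤ (g' + n • cornerUnit 2) 1 - (g' + n • cornerUnit 2) 0 := by
    have : B + 2 - (g' 1 - g' 0) ≤ n := Int.self_le_toNat _
    simp [cornerUnit]
    omega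
  -- the corner chain: from far away into `c₀`, then along the path up to the dart after `p`
  obtain ⟨Lb, hLb0, hLbchain, hLbhead, hLblast, hLbface⟩ :=
    exists_chain_of_reach (P := {f | E.IsInnerFace f}) hg₀ (c₀.2 + 3) hreach' 0
  set M := (List.range (i₁ + 3)).map (cornerOrbit (E.bcBondConfig ω) c₀) with hM
  have hMlen : M.length = i₁ + 3 := by simp [hM]
  have hMget : ∀ (i : ℕ) (h : i < M.length), M[i] = cornerOrbit (E.bcBondConfig ω) c₀ i := by
    intro i h; simp [hM]
  have hchain : (Lb ++ M).IsChain (fun q q' => ∃ β' : BondConfig (Site 2), q' = nextCorner β' q) := by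
    refine List.IsChain.append hLbchain (List.isChain_iff_getElem.2 fun i h => ⟨E.bcBondConfig ω, ?_⟩) ?_
    · rw [hMget, hMget, hstep]
    · intro x hx y hy
      rw [hLblast] at hx
      rw [hM, List.head?_map, List.head?_range] at hy
      simp only [Option.mem_def, Option.some.injEq, Nat.add_eq_zero_iff, OfNat.ofNat_ne_zero, and_false,
        ↓reduceIte, Option.map_some] at hx hy
      subst hx; subst hy
      refine ⟨∅, ?_⟩
      rw [nextCorner_of_not_mem (Set.notMem_empty _), cornerOrbit_zero, faceAt, sub_add_cancel,
        fin4_add_three_add_one]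
  have hlen : 2 ≤ (Lb ++ M).length := by rw [List.length_append, hMlen]; omega
  have hoff : ∀ q ∈ Lb ++ M, ∀ m, q ≠ cornerOrbit (E.bcBondConfig ω) (cornerPartner p) m := by
    intro q hq m hqm
    rcases List.mem_append.1 hq with hq | hq
    · exact hLbface q hq (hqm ▸ hLin m)
    · rw [hM, List.mem_map] at hq
      obtain ⟨i, -, rfl⟩ := hq
      exact hdisj m i hqm.symm
  have hfar : ∀ q ∈ (Lb ++ M).head?, B + 2 ≤ (cFace q) 1 - (cFace q) 0 := by
    intro q hq
    rw [List.head?_append, hLbhead] at hq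
    simp only [Option.some_or, Option.mem_def, Option.some.injEq] at hq
    subst hq
    rw [show cFace (g' + n • cornerUnit 2 + cornerOff 0, (0 : Fin 4)) = g' + n • cornerUnit 2 from
      faceAt_add_cornerOff _ _]
    exact hgfar
  have hidx : Lb.length + (i₁ + 1) + 1 < (Lb ++ M).length := by rw [List.length_append, hMlen]; omega
  obtain ⟨hw1, hw2⟩ := chainWinding_eq_zero (E.bcBondConfig ω) (cornerPartner p) Q (Lb ++ M) B hQ0 hQ hQmin
    hchain hlen hoff hBm hfar (Lb.length + (i₁ + 1)) hidx
  have hget : (Lb ++ M)[Lb.length + (i₁ + 1)] = cornerOrbit (E.bcBondConfig ω) c₀ (i₁ + 1) := by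
    rw [List.getElem_append_right (by omega)]
    simp [hM]
  rw [hget] at hw1 hw2
  -- the dart of the partner on the closed trail of the loop, and the two types of the trail
  have htrail := isTrail_cornerOrbit hQ0 hQ hQmin
  have hperP : (fun m => cpos (cornerOrbit (E.bcBondConfig ω) (cornerPartner p) m)) Q =
      (fun m => cpos (cornerOrbit (E.bcBondConfig ω) (cornerPartner p) m)) 0 := by
    simp only [hQ]; rfl
  have hd₀ : (cpos (cornerPartner p), cpos (nextCorner (E.bcBondConfig ω) (cornerPartner p))) ∈
      MedialTrail.cdarts ((List.range Q).map fun m => cpos (cornerOrbit (E.bcBondConfig ω) (cornerPartner p) m)) := by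
    rw [MedialTrail.cdarts_map_range _ hperP, List.mem_map]
    exact ⟨0, List.mem_range.2 hQ0, rfl⟩
  have hcases := MedialTrail.INV.rf_cases (MedialTrail.inv_of_isTrail _ htrail) htrail hd₀
  rw [lf_cpos_nextCorner, rf_cpos_nextCorner, cturn_cornerOrbit hQ0 hQ hQmin] at hcases
  by_cases hmem : cTgt p ∈ E.bcBondConfig ω
  · -- `e` open: the path follows `e` to the vertex of the partner; left faces agree
    rw [turnSign_of_mem hmem]
    have hv : (cornerOrbit (E.bcBondConfig ω) c₀ (i₁ + 1)).1 = (cornerPartner p).1 := by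
      rw [hstep, hi₁, nextCorner_of_mem hmem]; rfl
    rw [hv] at hw1
    rcases hcases with ⟨-, hl1, -, -⟩ | ⟨-, -, hc4, -⟩
    · rw [hw1] at hl1; exact absurd hl1 (by norm_num)
    · rw [hc4]; norm_num
  · -- `e` closed: the path crosses `e` into the face of the partner; right faces agree
    rw [turnSign_of_not_mem hmem]
    have hf : cFace (cornerOrbit (E.bcBondConfig ω) c₀ (i₁ + 1)) = cFace (cornerPartner p) := by
      rw [hstep, hi₁, cFace_nextCorner_of_not_mem hmem]
      change faceAt p.1 (p.2 + 1) = faceAt (p.1 + cornerUnit (p.2 + 1)) (p.2 + 2)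
      rw [← fin4_add_one_add_one, faceAt_add_unit_succ]
    rw [hf] at hw2
    rcases hcases with ⟨-, -, hc4, -⟩ | ⟨hr1, -, -, -⟩
    · rw [hc4]; norm_num
    · rw [hw2] at hr1; exact absurd hr1 (by norm_num)

end Summit.CriticalPhenomena.CardyFormulaZ2.Cruxes.EdgePrecompact.QkzStripBoundaryArm
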